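import Summits.BirchSwinnertonDyer.Rank1Residual.X9.PrintCertHowardCerts
import Summits.BirchSwinnertonDyer.Rank1Residual.X9.PrintCertRecordsCertifiedX10b
import Summits.BirchSwinnertonDyer.Rank1Residual.X9.PrintCertRecordsCertifiedX9Ns
import HarnessLib

/-!
# The Howard frame certificates PASS IN THE KERNEL — slices `X10bNsR1`, `Ns5A`, `Ns5B`, `Ns7` (records v4): display theorems, census

HONEST FRAMING (cell `bsd-print-x9`, D-0131 (2) print tier): theorems only; no named fact; nothing asserted about any elliptic curve beyond
what the kernel rechecks; no pair is booked and no leaf is closed (`BSDpOnClassX9`, `BSDpOnClassX10b` stay `@[conjecture]`; cruxes J = item 20392,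
J₃ = item 21340 stay OPEN). For each slice: `howardScreen_<Slice>` — every rank-`1` record has a Howard frame certificate (`X9/PrintCertHowardCerts.lean`)
passing `Record.howardCheck` (`X9/PrintCertHoward.lean`: the records-v3 Heegner frame check AND `D` odd AND `h(D)` RECOMPUTED by the kernel as the
number of reduced primitive forms (`Quadratic.BinQF.classNumber`) AND `p ∤ h(D)`), by `decide +kernel`; hence (soundness in `X9/PrintCertHoward.lean`)
for ANY imaginary quadratic `K` with `d_K = c.D` and ANY globally minimal `W / ℚ` with `integralModelInt W = r.intCurve`: `howardFrame_of_mem_<Slice>` —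
`K` satisfies the Heegner hypothesis for `N(W)` and for `p`, `|d_K| > 4`, `4N ∣ β² − d_K`, `d_K ≡ 1 (mod 8)` at `p = 3`, `Odd d_K`, `d_K ≠ -3, -4` and
**`¬ p ∣ NumberField.classNumber K`** (Cox Thm. 7.7(ii) by name: `ClassNumberValues.not_dvd_classNumber_of_discr_eq`) — every `K`-side hypothesis of
`ClassX9.mz26Hypotheses` / of the YZ26 composite of the cell's J-free Howard road, IN THE KERNEL. Census `howardCensus_<Slice>`: list sizes and the
J-screen profile (`v_p(m_K)` vs `t`) of the new frames (each new certificate is also a records-v3 frame with the `n = 1` screen).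

References: [Cox2013] §2.A Thm. 2.13, §7.B Thm. 7.7(ii); [MastellaZerman2026] Assumption 2.1, Cor. 4.6; [GrossZagier1986] I §3, V (2.2);
[Jetchev2008] Conj. 1.1; [GrossLMS1991] §1; [Marcus1977] Ch. 3 Thm. 25.
-/

set_option autoImplicit false

namespace Summit.BirchSwinnertonDyer.Rank1Residual.X9.PrintCert

open WeierstrassCurve Summit.BirchSwinnertonDyer.Rank1Residual.Additive
open Literature.NumberTheory.EllipticCurves (IsImaginaryQuadratic SatisfiesHeegnerHypothesis)

-- `decide +kernel` runs the frame arithmetic AND recomputes the class number `h(D)` (reduced forms, cost `O(|D|)`) for every certificate it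
-- visits: raise the recursion depth; elaborate the slices one after the other (memory).
set_option maxRecDepth 100000
set_option Elab.async false

/-! ## Slice `X10bNsR1` (39 rank-`1` records; 70 Howard frame certificates = 65 records-v3 certificates with `D` odd, `p ∤ h(D)` + 5 new) -/

/-- Every rank-`1` record of slice `X10bNsR1` has a Howard frame certificate passing `Record.howardCheck` — in particular `h(D)` recomputed and
`p ∤ h(D)` — IN THE KERNEL. [cite: MastellaZerman2026, Assumption 2.1] [cite: Cox2013, §2.A Thm. 2.13] -/
theorem howardScreen_X10bNsR1 : howardScreen recordsX10bNsR1 (fun r => r.rank == 1) howardCertsX10bNsR1 = true := by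
  decide +kernel

/-- Unpacked: a rank-`1` record of slice `X10bNsR1` has a passing Howard frame certificate in `howardCertsX10bNsR1`. [cite: MastellaZerman2026, Assumption 2.1] -/
theorem exists_howardCheck_of_mem_X10bNsR1 {r : Record} (hr : r ∈ recordsX10bNsR1) (h1 : r.rank = 1) :
    ∃ c ∈ howardCertsX10bNsR1, r.howardCheck c = true :=
  exists_howardCheck_of_howardScreen howardScreen_X10bNsR1 hr (by simp [h1])

/-- **THE HOWARD FRAME, slice `X10bNsR1`**: for a rank-`1` record, ANY imaginary quadratic `K` whose discriminant is the certificate's `D` satisfies,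
for ANY globally minimal `W` with the record's integral model: the Heegner hypothesis for `N(W)` and for `p`, `|d_K| > 4`, `4N ∣ β² − d_K` (record
conductor), `d_K ≡ 1 (mod 8)` at `p = 3`; `Odd d_K`; `d_K ≠ -3, -4`; and `¬ p ∣ h_K` — IN THE KERNEL. [cite: MastellaZerman2026, Assumption 2.1, Cor. 4.6]
[cite: Cox2013, §7.B Thm. 7.7(ii)] [cite: GrossLMS1991, §1 (p. 235)] -/
theorem howardFrame_of_mem_X10bNsR1 {r : Record} (hr : r ∈ recordsX10bNsR1) (h1 : r.rank = 1) {W : WeierstrassCurve ℚ} [W.IsElliptic]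
    [W.IsGloballyMinimal] (hI : integralModelInt W = r.intCurve) {K : Type} [Field K] [NumberField K]
    (hK : IsImaginaryQuadratic K) {q : ℕ} (hq : q = r.p) :
    ∃ c ∈ howardCertsX10bNsR1, r.howardCheck c = true ∧ (NumberField.discr K = c.D →
      (SatisfiesHeegnerHypothesis (W.conductorNorm ℤ) K ∧ SatisfiesHeegnerHypothesis q K ∧ 4 < (NumberField.discr K).natAbs ∧
        (4 * (r.conductor : ℤ)) ∣ (c.beta : ℤ) ^ 2 - NumberField.discr K ∧ (q = 3 → NumberField.discr K % 8 = 1)) ∧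
      Odd (NumberField.discr K) ∧ (NumberField.discr K ≠ -3 ∧ NumberField.discr K ≠ -4) ∧ ¬ q ∣ NumberField.classNumber K) := by
  obtain ⟨c, hc, hh⟩ := exists_howardCheck_of_mem_X10bNsR1 hr h1
  exact ⟨c, hc, hh, fun hd => Record.howardFrame_of_howardCheck hI (certified_X10bNsR1.check_of_mem hr) hh hK hd hq⟩

/-- KERNEL CENSUS, slice `X10bNsR1`: `howardCertsX10bNsR1` has 70 certificates (65 re-used records-v3 frames + 5 new) for the 39 rank-`1`
records; among the 5 NEW frames `v_p(m_K) = t` on 5, `> t` on 0, `< t` on 0. [cite: Jetchev2008, Conj. 1.1] -/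
theorem howardCensus_X10bNsR1 : (howardCertsX10bNsR1).length = 70 ∧ (howardCertsNewX10bNsR1).length = 5 ∧
    ((howardCertsNewX10bNsR1).filter fun c => c.indexVal == c.depth).length = 5 ∧
    ((howardCertsNewX10bNsR1).filter fun c => decide (c.depth < c.indexVal)).length = 0 ∧
    ((howardCertsNewX10bNsR1).filter fun c => decide (c.indexVal < c.depth)).length = 0 := by
  refine ⟨?_, ?_, ?_, ?_, ?_⟩ <;> decide +kernel

/-! ## Slice `Ns5A` (39 rank-`1` records; 55 Howard frame certificates = 43 records-v3 certificates with `D` odd, `p ∤ h(D)` + 12 new) -/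

/-- Every rank-`1` record of slice `Ns5A` has a Howard frame certificate passing `Record.howardCheck` — in particular `h(D)` recomputed and
`p ∤ h(D)` — IN THE KERNEL. [cite: MastellaZerman2026, Assumption 2.1] [cite: Cox2013, §2.A Thm. 2.13] -/
theorem howardScreen_Ns5A : howardScreen recordsNs5A (fun r => r.rank == 1) howardCertsNs5A = true := by
  decide +kernel

/-- Unpacked: a rank-`1` record of slice `Ns5A` has a passing Howard frame certificate in `howardCertsNs5A`. [cite: MastellaZerman2026, Assumption 2.1] -/
theorem exists_howardCheck_of_mem_Ns5A {r : Record} (hr : r ∈ recordsNs5A) (h1 : r.rank = 1) :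
    ∃ c ∈ howardCertsNs5A, r.howardCheck c = true :=
  exists_howardCheck_of_howardScreen howardScreen_Ns5A hr (by simp [h1])

/-- **THE HOWARD FRAME, slice `Ns5A`**: for a rank-`1` record, ANY imaginary quadratic `K` whose discriminant is the certificate's `D` satisfies,
for ANY globally minimal `W` with the record's integral model: the Heegner hypothesis for `N(W)` and for `p`, `|d_K| > 4`, `4N ∣ β² − d_K` (record
conductor), `d_K ≡ 1 (mod 8)` at `p = 3`; `Odd d_K`; `d_K ≠ -3, -4`; and `¬ p ∣ h_K` — IN THE KERNEL. [cite: MastellaZerman2026, Assumption 2.1, Cor. 4.6]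
[cite: Cox2013, §7.B Thm. 7.7(ii)] [cite: GrossLMS1991, §1 (p. 235)] -/
theorem howardFrame_of_mem_Ns5A {r : Record} (hr : r ∈ recordsNs5A) (h1 : r.rank = 1) {W : WeierstrassCurve ℚ} [W.IsElliptic]
    [W.IsGloballyMinimal] (hI : integralModelInt W = r.intCurve) {K : Type} [Field K] [NumberField K]
    (hK : IsImaginaryQuadratic K) {q : ℕ} (hq : q = r.p) :
    ∃ c ∈ howardCertsNs5A, r.howardCheck c = true ∧ (NumberField.discr K = c.D →
      (SatisfiesHeegnerHypothesis (W.conductorNorm ℤ) K ∧ SatisfiesHeegnerHypothesis q K ∧ 4 < (NumberField.discr K).natAbs ∧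
        (4 * (r.conductor : ℤ)) ∣ (c.beta : ℤ) ^ 2 - NumberField.discr K ∧ (q = 3 → NumberField.discr K % 8 = 1)) ∧
      Odd (NumberField.discr K) ∧ (NumberField.discr K ≠ -3 ∧ NumberField.discr K ≠ -4) ∧ ¬ q ∣ NumberField.classNumber K) := by
  obtain ⟨c, hc, hh⟩ := exists_howardCheck_of_mem_Ns5A hr h1
  exact ⟨c, hc, hh, fun hd => Record.howardFrame_of_howardCheck hI (certified_Ns5A.check_of_mem hr) hh hK hd hq⟩

/-- KERNEL CENSUS, slice `Ns5A`: `howardCertsNs5A` has 55 certificates (43 re-used records-v3 frames + 12 new) for the 39 rank-`1`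
records; among the 12 NEW frames `v_p(m_K) = t` on 11, `> t` on 1 (102752b1 at D = -231), `< t` on 0. [cite: Jetchev2008, Conj. 1.1] -/
theorem howardCensus_Ns5A : (howardCertsNs5A).length = 55 ∧ (howardCertsNewNs5A).length = 12 ∧
    ((howardCertsNewNs5A).filter fun c => c.indexVal == c.depth).length = 11 ∧
    ((howardCertsNewNs5A).filter fun c => decide (c.depth < c.indexVal)).length = 1 ∧
    ((howardCertsNewNs5A).filter fun c => decide (c.indexVal < c.depth)).length = 0 := by
  refine ⟨?_, ?_, ?_, ?_, ?_⟩ <;> decide +kernel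

/-! ## Slice `Ns5B` (29 rank-`1` records; 41 Howard frame certificates = 31 records-v3 certificates with `D` odd, `p ∤ h(D)` + 10 new) -/

/-- Every rank-`1` record of slice `Ns5B` has a Howard frame certificate passing `Record.howardCheck` — in particular `h(D)` recomputed and
`p ∤ h(D)` — IN THE KERNEL. [cite: MastellaZerman2026, Assumption 2.1] [cite: Cox2013, §2.A Thm. 2.13] -/
theorem howardScreen_Ns5B : howardScreen recordsNs5B (fun r => r.rank == 1) howardCertsNs5B = true := by
  decide +kernel

/-- Unpacked: a rank-`1` record of slice `Ns5B` has a passing Howard frame certificate in `howardCertsNs5B`. [cite: MastellaZerman2026, Assumption 2.1] -/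
theorem exists_howardCheck_of_mem_Ns5B {r : Record} (hr : r ∈ recordsNs5B) (h1 : r.rank = 1) :
    ∃ c ∈ howardCertsNs5B, r.howardCheck c = true :=
  exists_howardCheck_of_howardScreen howardScreen_Ns5B hr (by simp [h1])

/-- **THE HOWARD FRAME, slice `Ns5B`**: for a rank-`1` record, ANY imaginary quadratic `K` whose discriminant is the certificate's `D` satisfies,
for ANY globally minimal `W` with the record's integral model: the Heegner hypothesis for `N(W)` and for `p`, `|d_K| > 4`, `4N ∣ β² − d_K` (record
conductor), `d_K ≡ 1 (mod 8)` at `p = 3`; `Odd d_K`; `d_K ≠ -3, -4`; and `¬ p ∣ h_K` — IN THE KERNEL. [cite: MastellaZerman2026, Assumption 2.1, Cor. 4.6]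
[cite: Cox2013, §7.B Thm. 7.7(ii)] [cite: GrossLMS1991, §1 (p. 235)] -/
theorem howardFrame_of_mem_Ns5B {r : Record} (hr : r ∈ recordsNs5B) (h1 : r.rank = 1) {W : WeierstrassCurve ℚ} [W.IsElliptic]
    [W.IsGloballyMinimal] (hI : integralModelInt W = r.intCurve) {K : Type} [Field K] [NumberField K]
    (hK : IsImaginaryQuadratic K) {q : ℕ} (hq : q = r.p) :
    ∃ c ∈ howardCertsNs5B, r.howardCheck c = true ∧ (NumberField.discr K = c.D →
      (SatisfiesHeegnerHypothesis (W.conductorNorm ℤ) K ∧ SatisfiesHeegnerHypothesis q K ∧ 4 < (NumberField.discr K).natAbs ∧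
        (4 * (r.conductor : ℤ)) ∣ (c.beta : ℤ) ^ 2 - NumberField.discr K ∧ (q = 3 → NumberField.discr K % 8 = 1)) ∧
      Odd (NumberField.discr K) ∧ (NumberField.discr K ≠ -3 ∧ NumberField.discr K ≠ -4) ∧ ¬ q ∣ NumberField.classNumber K) := by
  obtain ⟨c, hc, hh⟩ := exists_howardCheck_of_mem_Ns5B hr h1
  exact ⟨c, hc, hh, fun hd => Record.howardFrame_of_howardCheck hI (certified_Ns5B.check_of_mem hr) hh hK hd hq⟩

/-- KERNEL CENSUS, slice `Ns5B`: `howardCertsNs5B` has 41 certificates (31 re-used records-v3 frames + 10 new) for the 29 rank-`1`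
records; among the 10 NEW frames `v_p(m_K) = t` on 8, `> t` on 2 (393129y1 at D = -299, 393129z1 at D = -299), `< t` on 0. [cite: Jetchev2008, Conj. 1.1] -/
theorem howardCensus_Ns5B : (howardCertsNs5B).length = 41 ∧ (howardCertsNewNs5B).length = 10 ∧
    ((howardCertsNewNs5B).filter fun c => c.indexVal == c.depth).length = 8 ∧
    ((howardCertsNewNs5B).filter fun c => decide (c.depth < c.indexVal)).length = 2 ∧
    ((howardCertsNewNs5B).filter fun c => decide (c.indexVal < c.depth)).length = 0 := by
  refine ⟨?_, ?_, ?_, ?_, ?_⟩ <;> decide +kernel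

/-! ## Slice `Ns7` (20 rank-`1` records; 36 Howard frame certificates = 36 records-v3 certificates with `D` odd, `p ∤ h(D)` + 0 new) -/

/-- Every rank-`1` record of slice `Ns7` has a Howard frame certificate passing `Record.howardCheck` — in particular `h(D)` recomputed and
`p ∤ h(D)` — IN THE KERNEL. [cite: MastellaZerman2026, Assumption 2.1] [cite: Cox2013, §2.A Thm. 2.13] -/
theorem howardScreen_Ns7 : howardScreen recordsNs7 (fun r => r.rank == 1) howardCertsNs7 = true := by
  decide +kernel

/-- Unpacked: a rank-`1` record of slice `Ns7` has a passing Howard frame certificate in `howardCertsNs7`. [cite: MastellaZerman2026, Assumption 2.1] -/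
theorem exists_howardCheck_of_mem_Ns7 {r : Record} (hr : r ∈ recordsNs7) (h1 : r.rank = 1) :
    ∃ c ∈ howardCertsNs7, r.howardCheck c = true :=
  exists_howardCheck_of_howardScreen howardScreen_Ns7 hr (by simp [h1])

/-- **THE HOWARD FRAME, slice `Ns7`**: for a rank-`1` record, ANY imaginary quadratic `K` whose discriminant is the certificate's `D` satisfies,
for ANY globally minimal `W` with the record's integral model: the Heegner hypothesis for `N(W)` and for `p`, `|d_K| > 4`, `4N ∣ β² − d_K` (record
conductor), `d_K ≡ 1 (mod 8)` at `p = 3`; `Odd d_K`; `d_K ≠ -3, -4`; and `¬ p ∣ h_K` — IN THE KERNEL. [cite: MastellaZerman2026, Assumption 2.1, Cor. 4.6]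
[cite: Cox2013, §7.B Thm. 7.7(ii)] [cite: GrossLMS1991, §1 (p. 235)] -/
theorem howardFrame_of_mem_Ns7 {r : Record} (hr : r ∈ recordsNs7) (h1 : r.rank = 1) {W : WeierstrassCurve ℚ} [W.IsElliptic]
    [W.IsGloballyMinimal] (hI : integralModelInt W = r.intCurve) {K : Type} [Field K] [NumberField K]
    (hK : IsImaginaryQuadratic K) {q : ℕ} (hq : q = r.p) :
    ∃ c ∈ howardCertsNs7, r.howardCheck c = true ∧ (NumberField.discr K = c.D →
      (SatisfiesHeegnerHypothesis (W.conductorNorm ℤ) K ∧ SatisfiesHeegnerHypothesis q K ∧ 4 < (NumberField.discr K).natAbs ∧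
        (4 * (r.conductor : ℤ)) ∣ (c.beta : ℤ) ^ 2 - NumberField.discr K ∧ (q = 3 → NumberField.discr K % 8 = 1)) ∧
      Odd (NumberField.discr K) ∧ (NumberField.discr K ≠ -3 ∧ NumberField.discr K ≠ -4) ∧ ¬ q ∣ NumberField.classNumber K) := by
  obtain ⟨c, hc, hh⟩ := exists_howardCheck_of_mem_Ns7 hr h1
  exact ⟨c, hc, hh, fun hd => Record.howardFrame_of_howardCheck hI (certified_Ns7.check_of_mem hr) hh hK hd hq⟩

/-- KERNEL CENSUS, slice `Ns7`: `howardCertsNs7` has 36 certificates (36 re-used records-v3 frames + 0 new) for the 20 rank-`1`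
records; among the 0 NEW frames `v_p(m_K) = t` on 0, `> t` on 0, `< t` on 0. [cite: Jetchev2008, Conj. 1.1] -/
theorem howardCensus_Ns7 : (howardCertsNs7).length = 36 ∧ (howardCertsNewNs7).length = 0 ∧
    ((howardCertsNewNs7).filter fun c => c.indexVal == c.depth).length = 0 ∧
    ((howardCertsNewNs7).filter fun c => decide (c.depth < c.indexVal)).length = 0 ∧
    ((howardCertsNewNs7).filter fun c => decide (c.indexVal < c.depth)).length = 0 := by
  refine ⟨?_, ?_, ?_, ?_, ?_⟩ <;> decide +kernel

end Summit.BirchSwinnertonDyer.Rank1Residual.X9.PrintCert
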